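import Literature.Analysis.ODE.HeunEulerTransform
import HarnessLib

/-!
# The Euler–Riemann–Liouville integrals `∫₀¹ (1−t)^{−κ} tʲ v⁽ʲ⁾(1+(z−1)t) dt` of a function with an
# algebraic branch point: convergence and differentiation under the integral sign

Topic `Literature/Analysis/ODE` (namespace `Literature.Analysis.ODE`, sub-namespace `GeneralHeun`;
continues `HeunEulerTransform.lean`).

This is the real-variable calculus behind the ONE-SIDED Euler transformation
`u(z) = ∫₁^z (z−w)^{−κ} v(w) dw = (z−1)^{1−κ} ∫₀¹ (1−t)^{−κ} v(1+(z−1)t) dt` (`Re κ < 1`) of a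
function `v` which is smooth on `(1, b)` and has an algebraic branch point at `w = 1`:
`‖v⁽ʲ⁾(w)‖ ≤ C_j (w−1)^{r−j}` near `1⁺` with `r > −1` (e.g. `v = (w−1)^ρ h(w)`, `h` smooth,
`r = Re ρ`). For such `v` the integrals
`Ψ_{κ,j}[v](z) = ∫₀¹ (1−t)^{−κ} tʲ v⁽ʲ⁾(1+(z−1)t) dt`
converge absolutely (majorant `t^r (1−t)^{−Re κ}`, a Beta integrand) and
`d/dz Ψ_{κ,j}[v] = Ψ_{κ,j+1}[v]` on `(1, b)` (differentiation under the integral sign, dominated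
convergence), so `z ↦ Ψ_{κ,0}[v](z)` is smooth on `(1,b)` with `j`-th derivative `Ψ_{κ,j}[v]`.
These are the analytic facts that the proof of K. Takemura's Proposition 1.2 [Takemura2017]
(Euler's integral transformation of Heun's equation, Kazakov–Slavyanov) consumes when the
Pochhammer contour is replaced by the real segment `(1, z)`; cf. the classical treatment of
Riemann–Liouville integrals of functions with an integrable algebraic singularity
[SamkoKilbasMarichev1993, §2]. Everything here is proved; no named facts are introduced.

## References
* K. Takemura, J. Math. Soc. Japan 69 (2017) 849–891, Prop. 1.2. Key `Takemura2017`.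
* S. G. Samko, A. A. Kilbas, O. I. Marichev, *Fractional integrals and derivatives*, Gordon and
  Breach 1993, §2 (Riemann–Liouville integrals on a finite interval). [folklore]
-/

noncomputable section

open Set Filter MeasureTheory intervalIntegral
open scoped Topology Interval

namespace Literature.Analysis.ODE

namespace GeneralHeun

/-! ### The kernel profile `k_κ(u) = u^{−κ}`: size and continuity -/

/-- `‖k_κ(u)‖ = u^{−Re κ}` for `u > 0`. [cite: Takemura2017, Proposition 1.2 (kernel)] -/
theorem norm_eulerKernel (κ : ℂ) {u : ℝ} (hu : 0 < u) : ‖eulerKernel κ u‖ = u ^ (-κ.re) := by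
  unfold eulerKernel
  rw [Complex.norm_exp, Real.rpow_def_of_pos hu]
  congr 1
  simp [Complex.mul_re]
  ring

/-- `k_κ` is continuous on `(0, ∞)`. [cite: Takemura2017, Proposition 1.2 (kernel)] -/
theorem continuousOn_eulerKernel (κ : ℂ) : ContinuousOn (eulerKernel κ) (Ioi 0) := by
  unfold eulerKernel
  refine Continuous.comp_continuousOn Complex.continuous_exp ?_
  refine ContinuousOn.mul continuousOn_const ?_
  refine Complex.continuous_ofReal.comp_continuousOn ?_
  exact Real.continuousOn_log.mono fun u hu => ne_of_gt hu

/-- `t ↦ k_κ(1 − t)` is continuous on `(−∞, 1)`. [cite: Takemura2017, Proposition 1.2 (kernel)] -/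
theorem continuousOn_eulerKernel_one_sub (κ : ℂ) :
    ContinuousOn (fun t : ℝ => eulerKernel κ (1 - t)) (Iio 1) := by
  refine (continuousOn_eulerKernel κ).comp (continuousOn_const.sub continuousOn_id) ?_
  intro t ht
  exact sub_pos.mpr (mem_Iio.mp ht)

/-! ### The Beta majorant `t^r (1−t)^a` -/

/-- For `0 < a ≤ x ≤ c` and any real exponent `e`, `x^e ≤ a^e + c^e`. [folklore] -/
private theorem rpow_le_rpow_add_rpow {a x c e : ℝ} (ha : 0 < a) (hax : a ≤ x) (hxc : x ≤ c) :
    x ^ e ≤ a ^ e + c ^ e := by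
  have hx : 0 < x := ha.trans_le hax
  rcases le_or_gt 0 e with he | he
  · have h1 : x ^ e ≤ c ^ e := Real.rpow_le_rpow hx.le hxc he
    have h2 : 0 ≤ a ^ e := Real.rpow_nonneg ha.le e
    linarith
  · have h1 : x ^ e ≤ a ^ e := Real.rpow_le_rpow_of_nonpos ha hax he.le
    have h2 : 0 ≤ c ^ e := Real.rpow_nonneg (hx.le.trans hxc) e
    linarith

/-- The Beta integrand `t^r (1−t)^a` is integrable on `[0,1]` for `r, a > −1` (convergence of
Euler's beta integral). [cite: SamkoKilbasMarichev1993, Ch. 1 §1.3 (beta function)] -/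
theorem intervalIntegrable_rpow_mul_one_sub_rpow {r a : ℝ} (hr : -1 < r) (ha : -1 < a) :
    IntervalIntegrable (fun t : ℝ => t ^ r * (1 - t) ^ a) volume 0 1 := by
  -- on `[0, 1/2]`: `t^r` integrable, `(1−t)^a` continuous; on `[1/2, 1]`: the other way round
  have h1 : IntervalIntegrable (fun t : ℝ => t ^ r * (1 - t) ^ a) volume 0 (1 / 2) := by
    refine (intervalIntegral.intervalIntegrable_rpow' hr).mul_continuousOn ?_
    refine ContinuousOn.rpow_const (continuousOn_const.sub continuousOn_id) ?_
    intro t ht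
    left
    rw [uIcc_of_le (by norm_num : (0 : ℝ) ≤ 1 / 2)] at ht
    have : t ≤ 1 / 2 := ht.2
    linarith
  have h2 : IntervalIntegrable (fun t : ℝ => t ^ r * (1 - t) ^ a) volume (1 / 2) 1 := by
    have h2a : IntervalIntegrable (fun t : ℝ => (1 - t) ^ a) volume (1 / 2) 1 := by
      have h := (intervalIntegral.intervalIntegrable_rpow' ha (a := 1 - 1 / 2) (b := 1 - 1)).comp_sub_left 1
      simpa using h
    refine (h2a.continuousOn_mul ?_)
    refine ContinuousOn.rpow_const continuousOn_id ?_
    intro t ht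
    left
    rw [uIcc_of_le (by norm_num : (1 / 2 : ℝ) ≤ 1)] at ht
    have : 1 / 2 ≤ t := ht.1
    exact ne_of_gt (by linarith)
  exact h1.trans h2

/-! ### Smooth functions on an open interval: the chain of iterated derivatives -/

/-- On an open set, the iterated derivatives of a smooth function form a chain of honest
derivatives. [folklore] -/
private theorem hasDerivAt_iteratedDeriv_of_contDiffOn {v : ℝ → ℂ} {U : Set ℝ} (hU : IsOpen U)
    (hv : ContDiffOn ℝ ((⊤ : ℕ∞) : WithTop ℕ∞) v U) (j : ℕ) {w : ℝ} (hw : w ∈ U) :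
    HasDerivAt (iteratedDeriv j v) (iteratedDeriv (j + 1) v w) w := by
  have hdiff : DifferentiableOn ℝ (iteratedDerivWithin j v U) U :=
    hv.differentiableOn_iteratedDerivWithin (WithTop.coe_lt_coe.2 (ENat.coe_lt_top j))
      hU.uniqueDiffOn
  have heq : iteratedDerivWithin j v U =ᶠ[𝓝 w] iteratedDeriv j v := by
    filter_upwards [hU.mem_nhds hw] with x hx using iteratedDerivWithin_of_isOpen hU hx
  have h1 : DifferentiableAt ℝ (iteratedDeriv j v) w :=
    ((hdiff w hw).differentiableAt (hU.mem_nhds hw)).congr_of_eventuallyEq heq.symm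
  rw [iteratedDeriv_succ]
  exact h1.hasDerivAt

/-- The iterated derivatives of a smooth function on an open set are continuous there.
[folklore] -/
private theorem continuousOn_iteratedDeriv_of_contDiffOn {v : ℝ → ℂ} {U : Set ℝ} (hU : IsOpen U)
    (hv : ContDiffOn ℝ ((⊤ : ℕ∞) : WithTop ℕ∞) v U) (j : ℕ) :
    ContinuousOn (iteratedDeriv j v) U := fun _ hw =>
  (hasDerivAt_iteratedDeriv_of_contDiffOn hU hv j hw).continuousAt.continuousWithinAt

/-! ### The class: algebraic blow-up of the derivatives at `w = 1` -/

/-- **Derivative bounds of branch type.** `EulerBound v r B`: for every `j` there is `C_j` with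
`‖v⁽ʲ⁾(w)‖ ≤ C_j (w−1)^{r−j}` for `1 < w < B` — the size of the derivatives of `(w−1)^ρ h(w)`,
`h` smooth, `Re ρ = r`. [cite: SamkoKilbasMarichev1993, §2 (functions with an integrable
algebraic singularity)] -/
def EulerBound (v : ℝ → ℂ) (r B : ℝ) : Prop :=
  ∀ j : ℕ, ∃ C : ℝ, ∀ w ∈ Ioo 1 B, ‖iteratedDeriv j v w‖ ≤ C * (w - 1) ^ (r - (j : ℝ))

/-- Shrinking the interval preserves the bounds. [cite: SamkoKilbasMarichev1993, §2] -/
theorem EulerBound.mono {v : ℝ → ℂ} {r B B' : ℝ} (h : EulerBound v r B) (hB : B' ≤ B) :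
    EulerBound v r B' := fun j => by
  obtain ⟨C, hC⟩ := h j
  exact ⟨C, fun w hw => hC w ⟨hw.1, hw.2.trans_le hB⟩⟩

/-! ### The integrand `(1−t)^{−κ} tʲ v⁽ʲ⁾(1+(z−1)t)` -/

/-- The integrand of `Ψ_{κ,j}[v](z)`: `(1−t)^{−κ} · tʲ · v⁽ʲ⁾(1+(z−1)t)`.
[cite: Takemura2017, Proposition 1.2] -/
def eulerΨIntegrand (κ : ℂ) (v : ℝ → ℂ) (j : ℕ) (z t : ℝ) : ℂ :=
  eulerKernel κ (1 - t) * ((t : ℂ) ^ j * iteratedDeriv j v (eulerPt z t))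

/-- `Ψ_{κ,j}[v](z) = ∫₀¹ (1−t)^{−κ} tʲ v⁽ʲ⁾(1+(z−1)t) dt`. For `j = 0` and `Re κ < 1`,
`(z−1)^{1−κ} Ψ_{κ,0}[v](z) = ∫₁^z (z−w)^{−κ} v(w) dw` is the one-sided Euler / Riemann–Liouville
transform of `v`. [cite: Takemura2017, Proposition 1.2] -/
def eulerΨ (κ : ℂ) (v : ℝ → ℂ) (j : ℕ) (z : ℝ) : ℂ :=
  ∫ t in (0 : ℝ)..1, eulerΨIntegrand κ v j z t

/-- For `1 < z` and `0 < t < 1` the point `1+(z−1)t` lies in `(1, z)`.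
[cite: Takemura2017, Proposition 1.2] -/
theorem eulerPt_mem_Ioo {z t : ℝ} (hz : 1 < z) (ht : t ∈ Ioo (0 : ℝ) 1) :
    eulerPt z t ∈ Ioo 1 z := by
  unfold eulerPt
  have hz1 : 0 < z - 1 := sub_pos.mpr hz
  constructor
  · nlinarith [ht.1]
  · nlinarith [ht.2]

/-- For `1 < z` and `0 < t ≤ 1` the point `1+(z−1)t` lies in `(1, z]`.
[cite: Takemura2017, Proposition 1.2] -/
theorem eulerPt_mem_Ioc {z t : ℝ} (hz : 1 < z) (ht : t ∈ Ioc (0 : ℝ) 1) :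
    eulerPt z t ∈ Ioc 1 z := by
  unfold eulerPt
  have hz1 : 0 < z - 1 := sub_pos.mpr hz
  constructor
  · nlinarith [ht.1]
  · nlinarith [ht.2]

/-- `1+(z−1)t − 1 = (z−1)t`. [cite: Takemura2017, Proposition 1.2] -/
theorem eulerPt_sub_one (z t : ℝ) : eulerPt z t - 1 = (z - 1) * t := by
  unfold eulerPt; ring

/-- The integrand is continuous in `t` on `(0,1)` when `v` is smooth on `(1,b)` and `1 < z ≤ b`.
[cite: Takemura2017, Proposition 1.2] -/
theorem continuousOn_eulerΨIntegrand {v : ℝ → ℂ} {b : ℝ}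
    (hv : ContDiffOn ℝ ((⊤ : ℕ∞) : WithTop ℕ∞) v (Ioo 1 b)) (κ : ℂ) (j : ℕ) {z : ℝ} (hz : 1 < z)
    (hzb : z ≤ b) : ContinuousOn (eulerΨIntegrand κ v j z) (Ioo 0 1) := by
  unfold eulerΨIntegrand
  refine ContinuousOn.mul ((continuousOn_eulerKernel_one_sub κ).mono fun t ht => ht.2) ?_
  refine ContinuousOn.mul (Complex.continuous_ofReal.continuousOn.pow j) ?_
  have hcont := continuousOn_iteratedDeriv_of_contDiffOn isOpen_Ioo hv j
  refine hcont.comp ?_ ?_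
  · unfold eulerPt
    exact (continuousOn_const.add (continuousOn_const.mul continuousOn_id))
  · intro t ht
    have h := eulerPt_mem_Ioo hz ht
    exact ⟨h.1, h.2.trans_le hzb⟩

/-- The integrand is a.e.-strongly measurable on `Ι 0 1`. [cite: Takemura2017, Proposition 1.2] -/
theorem aestronglyMeasurable_eulerΨIntegrand {v : ℝ → ℂ} {b : ℝ}
    (hv : ContDiffOn ℝ ((⊤ : ℕ∞) : WithTop ℕ∞) v (Ioo 1 b)) (κ : ℂ) (j : ℕ) {z : ℝ} (hz : 1 < z)
    (hzb : z ≤ b) :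
    AEStronglyMeasurable (eulerΨIntegrand κ v j z) (volume.restrict (Ι (0 : ℝ) 1)) := by
  rw [uIoc_of_le zero_le_one, ← Measure.restrict_congr_set Ioo_ae_eq_Ioc]
  exact (continuousOn_eulerΨIntegrand hv κ j hz hzb).aestronglyMeasurable measurableSet_Ioo

/-- **Pointwise majorant.** Under `EulerBound v r B`, for `1 < z < B`, `0 < t < 1`:
`‖(1−t)^{−κ} tʲ v⁽ʲ⁾(1+(z−1)t)‖ ≤ C_j (z−1)^{r−j} · t^r (1−t)^{−Re κ}`.
[cite: SamkoKilbasMarichev1993, §2] -/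
theorem norm_eulerΨIntegrand_le {v : ℝ → ℂ} {r B : ℝ} {j : ℕ} {C : ℝ}
    (hC : ∀ w ∈ Ioo 1 B, ‖iteratedDeriv j v w‖ ≤ C * (w - 1) ^ (r - (j : ℝ))) (κ : ℂ) {z : ℝ}
    (hz : 1 < z) (hzB : z ≤ B) {t : ℝ} (ht : t ∈ Ioo (0 : ℝ) 1) :
    ‖eulerΨIntegrand κ v j z t‖ ≤
      C * (z - 1) ^ (r - (j : ℝ)) * (t ^ r * (1 - t) ^ (-κ.re)) := by
  have hz1 : 0 < z - 1 := sub_pos.mpr hz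
  have ht0 : 0 < t := ht.1
  have ht1 : 0 < 1 - t := sub_pos.mpr ht.2
  have hw := eulerPt_mem_Ioo hz ht
  have hwB : eulerPt z t ∈ Ioo 1 B := ⟨hw.1, hw.2.trans_le hzB⟩
  have hb := hC _ hwB
  rw [eulerPt_sub_one] at hb
  unfold eulerΨIntegrand
  rw [norm_mul, norm_mul, norm_eulerKernel κ ht1, norm_pow, Complex.norm_real, Real.norm_eq_abs,
    abs_of_pos ht0]
  -- `t^j · ((z−1)t)^{r−j} = (z−1)^{r−j} t^r`
  have hsplit : (t : ℝ) ^ j * ((z - 1) * t) ^ (r - (j : ℝ)) = (z - 1) ^ (r - (j : ℝ)) * t ^ r := by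
    rw [Real.mul_rpow hz1.le ht0.le, ← Real.rpow_natCast t j]
    have : t ^ (j : ℝ) * t ^ (r - (j : ℝ)) = t ^ r := by
      rw [← Real.rpow_add ht0]; ring_nf
    calc t ^ (j : ℝ) * ((z - 1) ^ (r - (j : ℝ)) * t ^ (r - (j : ℝ)))
        = (z - 1) ^ (r - (j : ℝ)) * (t ^ (j : ℝ) * t ^ (r - (j : ℝ))) := by ring
      _ = (z - 1) ^ (r - (j : ℝ)) * t ^ r := by rw [this]
  have hCnn : 0 ≤ C * ((z - 1) * t) ^ (r - (j : ℝ)) := le_trans (norm_nonneg _) hb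
  calc (1 - t) ^ (-κ.re) * (t ^ j * ‖iteratedDeriv j v (eulerPt z t)‖)
      ≤ (1 - t) ^ (-κ.re) * (t ^ j * (C * ((z - 1) * t) ^ (r - (j : ℝ)))) := by
        gcongr
    _ = C * ((t : ℝ) ^ j * ((z - 1) * t) ^ (r - (j : ℝ))) * (1 - t) ^ (-κ.re) := by ring
    _ = C * (z - 1) ^ (r - (j : ℝ)) * (t ^ r * (1 - t) ^ (-κ.re)) := by rw [hsplit]; ring

/-- **Absolute convergence.** For `v` smooth on `(1,b)` with `EulerBound v r B` (`B ≤ b`),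
`r > −1`, `Re κ < 1` and `1 < z < B`, the integrand of `Ψ_{κ,j}[v](z)` is integrable on `[0,1]`.
[cite: SamkoKilbasMarichev1993, §2] -/
theorem intervalIntegrable_eulerΨIntegrand {v : ℝ → ℂ} {b r B : ℝ} {κ : ℂ}
    (hv : ContDiffOn ℝ ((⊤ : ℕ∞) : WithTop ℕ∞) v (Ioo 1 b)) (hbd : EulerBound v r B) (hBb : B ≤ b)
    (hr : -1 < r) (hκ : κ.re < 1) (j : ℕ) {z : ℝ} (hz : 1 < z) (hzB : z ≤ B) :
    IntervalIntegrable (eulerΨIntegrand κ v j z) volume 0 1 := by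
  obtain ⟨C, hC⟩ := hbd j
  have hmaj := (intervalIntegrable_rpow_mul_one_sub_rpow hr (by linarith : -1 < -κ.re)).const_mul
    (C * (z - 1) ^ (r - (j : ℝ)))
  refine hmaj.mono_fun' (aestronglyMeasurable_eulerΨIntegrand hv κ j hz (hzB.trans hBb)) ?_
  rw [uIoc_of_le zero_le_one]
  rw [Filter.EventuallyLE, ae_restrict_iff' measurableSet_Ioc]
  have h1 : ∀ᵐ t : ℝ ∂volume, t ≠ 1 := by
    have : ({1}ᶜ : Set ℝ) ∈ ae volume := by
      rw [compl_mem_ae_iff]; exact measure_singleton 1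
    filter_upwards [this] with t ht using ht
  filter_upwards [h1] with t ht1 ht
  have ht' : t ∈ Ioo (0 : ℝ) 1 := ⟨ht.1, lt_of_le_of_ne ht.2 ht1⟩
  exact norm_eulerΨIntegrand_le hC κ hz hzB ht'

/-! ### Differentiation under the integral sign -/

/-- **`d/dz Ψ_{κ,j}[v] = Ψ_{κ,j+1}[v]`** on `(1, B)`: for `v` smooth on `(1,b)` with
`EulerBound v r B` (`B ≤ b`), `r > −1`, `Re κ < 1`, the `z`-derivative of
`∫₀¹ (1−t)^{−κ} tʲ v⁽ʲ⁾(1+(z−1)t) dt` may be taken under the integral sign, where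
`∂_z[tʲ v⁽ʲ⁾(1+(z−1)t)] = t^{j+1} v⁽ʲ⁺¹⁾(1+(z−1)t)` (dominated convergence with the Beta majorant
`t^r(1−t)^{−Re κ}`, locally uniformly in `z`). [cite: SamkoKilbasMarichev1993, §2] -/
theorem hasDerivAt_eulerΨ {v : ℝ → ℂ} {b r B : ℝ} {κ : ℂ}
    (hv : ContDiffOn ℝ ((⊤ : ℕ∞) : WithTop ℕ∞) v (Ioo 1 b)) (hbd : EulerBound v r B) (hBb : B ≤ b)
    (hr : -1 < r) (hκ : κ.re < 1) (j : ℕ) {z : ℝ} (hz : 1 < z) (hzB : z < B) :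
    HasDerivAt (eulerΨ κ v j) (eulerΨ κ v (j + 1) z) z := by
  obtain ⟨C, hC⟩ := hbd (j + 1)
  -- a neighbourhood `(z−d, z+d) ⊂ (1, B)`
  set d : ℝ := min (z - 1) (B - z) / 2 with hd
  have hd0 : 0 < d := by
    rw [hd]; have := lt_min (sub_pos.mpr hz) (sub_pos.mpr hzB); linarith
  have hd1 : 1 < z - d := by
    have : min (z - 1) (B - z) ≤ z - 1 := min_le_left _ _
    rw [hd]; linarith
  have hd2 : z + d < B := by
    have : min (z - 1) (B - z) ≤ B - z := min_le_right _ _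
    rw [hd]; linarith
  set s : Set ℝ := Ioo (z - d) (z + d) with hs_def
  have hs : s ∈ 𝓝 z := Ioo_mem_nhds (by linarith) (by linarith)
  have hsub : ∀ x ∈ s, 1 < x ∧ x < B := fun x hx => ⟨hd1.trans hx.1, hx.2.trans hd2⟩
  set e : ℝ := r - ((j + 1 : ℕ) : ℝ) with he
  set M : ℝ := (z - d - 1) ^ e + (z + d - 1) ^ e with hM
  have key := intervalIntegral.hasDerivAt_integral_of_dominated_loc_of_deriv_le
    (μ := volume) (a := 0) (b := 1) (F := fun ζ t => eulerΨIntegrand κ v j ζ t)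
    (F' := fun ζ t => eulerΨIntegrand κ v (j + 1) ζ t) (x₀ := z) (s := s)
    (bound := fun t => |C| * M * (t ^ r * (1 - t) ^ (-κ.re))) hs ?_ ?_ ?_ ?_ ?_ ?_
  · exact key.2
  · filter_upwards [hs] with x hx
    exact aestronglyMeasurable_eulerΨIntegrand hv κ j (hsub x hx).1 ((hsub x hx).2.le.trans hBb)
  · exact intervalIntegrable_eulerΨIntegrand hv hbd hBb hr hκ j hz hzB.le
  · exact aestronglyMeasurable_eulerΨIntegrand hv κ (j + 1) hz (hzB.le.trans hBb)
  · have h1 : ∀ᵐ t : ℝ ∂volume, t ≠ 1 := by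
      have : ({1}ᶜ : Set ℝ) ∈ ae volume := by
        rw [compl_mem_ae_iff]; exact measure_singleton 1
      filter_upwards [this] with t ht using ht
    filter_upwards [h1] with t ht1 ht x hx
    rw [uIoc_of_le zero_le_one] at ht
    have ht' : t ∈ Ioo (0 : ℝ) 1 := ⟨ht.1, lt_of_le_of_ne ht.2 ht1⟩
    obtain ⟨hx1, hxB⟩ := hsub x hx
    have hb := norm_eulerΨIntegrand_le hC κ hx1 hxB.le ht'
    refine hb.trans ?_
    have hnn : 0 ≤ t ^ r * (1 - t) ^ (-κ.re) :=
      mul_nonneg (Real.rpow_nonneg ht'.1.le _) (Real.rpow_nonneg (sub_pos.mpr ht'.2).le _)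
    have hxe : (x - 1) ^ e ≤ M :=
      rpow_le_rpow_add_rpow (by linarith) (by linarith [hx.1]) (by linarith [hx.2])
    have hxe0 : 0 ≤ (x - 1) ^ e := Real.rpow_nonneg (by linarith) _
    have hCe : C * (x - 1) ^ e ≤ |C| * M :=
      (mul_le_mul_of_nonneg_right (le_abs_self C) hxe0).trans
        (mul_le_mul_of_nonneg_left hxe (abs_nonneg C))
    exact mul_le_mul_of_nonneg_right hCe hnn
  · exact (intervalIntegrable_rpow_mul_one_sub_rpow hr (by linarith : -1 < -κ.re)).const_mul _
  · refine Eventually.of_forall fun t ht x hx => ?_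
    rw [uIoc_of_le zero_le_one] at ht
    obtain ⟨hx1, hxB⟩ := hsub x hx
    have hw : eulerPt x t ∈ Ioo 1 b := by
      have h := eulerPt_mem_Ioc hx1 ht
      exact ⟨h.1, lt_of_le_of_lt h.2 (hxB.trans_le hBb)⟩
    have hD := (hasDerivAt_iteratedDeriv_of_contDiffOn isOpen_Ioo hv j hw).scomp x
      (hasDerivAt_eulerPt_z x t)
    have h := (hD.const_mul ((t : ℂ) ^ j)).const_mul (eulerKernel κ (1 - t))
    unfold eulerΨIntegrand
    refine h.congr_deriv ?_
    rw [Complex.real_smul]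
    ring

/-- Consequently `z ↦ Ψ_{κ,j}[v](z)` is differentiable on `(1,B)` with derivative `Ψ_{κ,j+1}[v]`.
[cite: SamkoKilbasMarichev1993, §2] -/
theorem deriv_eulerΨ {v : ℝ → ℂ} {b r B : ℝ} {κ : ℂ}
    (hv : ContDiffOn ℝ ((⊤ : ℕ∞) : WithTop ℕ∞) v (Ioo 1 b)) (hbd : EulerBound v r B) (hBb : B ≤ b)
    (hr : -1 < r) (hκ : κ.re < 1) (j : ℕ) {z : ℝ} (hz : z ∈ Ioo 1 B) :
    deriv (eulerΨ κ v j) z = eulerΨ κ v (j + 1) z :=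
  (hasDerivAt_eulerΨ hv hbd hBb hr hκ j hz.1 hz.2).deriv

/-- **All orders.** The `m`-th derivative of `z ↦ Ψ_{κ,j}[v](z)` on `(1,B)` is `Ψ_{κ,j+m}[v]`.
[cite: SamkoKilbasMarichev1993, §2] -/
theorem iteratedDeriv_eulerΨ {v : ℝ → ℂ} {b r B : ℝ} {κ : ℂ}
    (hv : ContDiffOn ℝ ((⊤ : ℕ∞) : WithTop ℕ∞) v (Ioo 1 b)) (hbd : EulerBound v r B) (hBb : B ≤ b)
    (hr : -1 < r) (hκ : κ.re < 1) (m j : ℕ) {z : ℝ} (hz : z ∈ Ioo 1 B) :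
    iteratedDeriv m (eulerΨ κ v j) z = eulerΨ κ v (j + m) z := by
  induction m generalizing z with
  | zero => simp
  | succ m ih =>
    rw [iteratedDeriv_succ]
    have hloc : iteratedDeriv m (eulerΨ κ v j) =ᶠ[𝓝 z] eulerΨ κ v (j + m) := by
      filter_upwards [Ioo_mem_nhds hz.1 hz.2] with x hx using ih hx
    rw [hloc.deriv_eq, deriv_eulerΨ hv hbd hBb hr hκ (j + m) hz, Nat.add_assoc]

/-- **Smoothness.** `z ↦ Ψ_{κ,j}[v](z)` is `C^∞` on `(1, B)`. [cite: SamkoKilbasMarichev1993, §2] -/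
theorem contDiffOn_eulerΨ {v : ℝ → ℂ} {b r B : ℝ} {κ : ℂ}
    (hv : ContDiffOn ℝ ((⊤ : ℕ∞) : WithTop ℕ∞) v (Ioo 1 b)) (hbd : EulerBound v r B) (hBb : B ≤ b)
    (hr : -1 < r) (hκ : κ.re < 1) (j : ℕ) :
    ContDiffOn ℝ ((⊤ : ℕ∞) : WithTop ℕ∞) (eulerΨ κ v j) (Ioo 1 B) := by
  have hdiff : ∀ j, DifferentiableOn ℝ (eulerΨ κ v j) (Ioo 1 B) := fun j z hz =>
    (hasDerivAt_eulerΨ hv hbd hBb hr hκ j hz.1 hz.2).differentiableAt.differentiableWithinAt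
  have hnat : ∀ n : ℕ, ∀ j, ContDiffOn ℝ (n : WithTop ℕ∞) (eulerΨ κ v j) (Ioo 1 B) := by
    intro n
    induction n with
    | zero => exact fun j => contDiffOn_zero.2 (hdiff j).continuousOn
    | succ n ih =>
      intro j
      have h := (contDiffOn_succ_iff_deriv_of_isOpen (𝕜 := ℝ) (n := (n : WithTop ℕ∞))
        (f := eulerΨ κ v j) isOpen_Ioo).2 ⟨hdiff j, fun h => absurd h (by simp), ?_⟩
      · exact_mod_cast h
      · exact (ih (j + 1)).congr fun z hz => deriv_eulerΨ hv hbd hBb hr hκ j hz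
  exact contDiffOn_infty.2 fun n => hnat n j

/-! ### Two elementary limits -/

/-- `(1−t)^p → 0` as `t → 1⁻` (`p > 0`). [folklore] -/
private theorem tendsto_one_sub_rpow_nhdsLT_one {p : ℝ} (hp : 0 < p) :
    Tendsto (fun t : ℝ => (1 - t) ^ p) (𝓝[<] 1) (𝓝 0) := by
  have hc : Continuous fun t : ℝ => (1 - t) ^ p :=
    (continuous_const.sub continuous_id).rpow_const fun _ => Or.inr hp.le
  have h := hc.tendsto 1
  rw [sub_self, Real.zero_rpow hp.ne'] at h
  exact h.mono_left nhdsWithin_le_nhds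

/-- `t^p → 0` as `t → 0⁺` (`p > 0`). [folklore] -/
private theorem tendsto_rpow_nhdsGT_zero {p : ℝ} (hp : 0 < p) :
    Tendsto (fun t : ℝ => t ^ p) (𝓝[>] 0) (𝓝 0) := by
  have h := (Real.continuous_rpow_const hp.le).tendsto 0
  rw [Real.zero_rpow hp.ne'] at h
  exact h.mono_left nhdsWithin_le_nhds

/-! ### The recursion in the exponent -/

/-- **Recursion `∂_z Φ_{κ−1} = (1−κ) Φ_κ` at the level of the `Ψ`-integrals.** For `Re κ < 1`:
`(2−κ) Ψ_{κ−1,0}[v](z) + (z−1) Ψ_{κ−1,1}[v](z) = (1−κ) Ψ_{κ,0}[v](z)`, i.e.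
`d/dz [(z−1)^{2−κ} Ψ_{κ−1,0}] = (1−κ)(z−1)^{1−κ} Ψ_{κ,0}` — the identity
`d/dz ∫₁^z (z−w)^{1−κ} v = (1−κ) ∫₁^z (z−w)^{−κ} v`. It is `∫₀¹ ∂_t[t (1−t)^{1−κ} v(1+(z−1)t)] dt = 0`,
both boundary values vanishing (`Re κ < 1` at `t = 1`, `r > −1` at `t = 0`).
[cite: SamkoKilbasMarichev1993, §2 (differentiation of Riemann–Liouville integrals)] -/
theorem eulerΨ_recursion {v : ℝ → ℂ} {b r B : ℝ} {κ : ℂ}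
    (hv : ContDiffOn ℝ ((⊤ : ℕ∞) : WithTop ℕ∞) v (Ioo 1 b)) (hbd : EulerBound v r B) (hBb : B ≤ b)
    (hr : -1 < r) (hκ : κ.re < 1) {z : ℝ} (hz : 1 < z) (hzB : z < B) :
    (2 - κ) * eulerΨ (κ - 1) v 0 z + ((z - 1 : ℝ) : ℂ) * eulerΨ (κ - 1) v 1 z =
      (1 - κ) * eulerΨ κ v 0 z := by
  have hκ' : (κ - 1).re < 1 := by simp; linarith
  have hzb : z < b := hzB.trans_le hBb
  obtain ⟨C₀, hC₀⟩ := hbd 0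
  -- `Φ(t) = k_{κ−1}(1−t) · t · v(1+(z−1)t)` and its `t`-derivative `φ`
  set Φ : ℝ → ℂ := fun t => eulerKernel (κ - 1) (1 - t) * ((t : ℂ) * v (eulerPt z t)) with hΦ
  set φ : ℝ → ℂ := fun t => (2 - κ) * eulerΨIntegrand (κ - 1) v 0 z t +
      ((z - 1 : ℝ) : ℂ) * eulerΨIntegrand (κ - 1) v 1 z t - (1 - κ) * eulerΨIntegrand κ v 0 z t
    with hφ
  have hderiv : ∀ t ∈ Ioo (0 : ℝ) 1, HasDerivAt Φ (φ t) t := by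
    intro t ht
    have ht1 : 0 < 1 - t := sub_pos.mpr ht.2
    have hw : eulerPt z t ∈ Ioo 1 b := by
      have h := eulerPt_mem_Ioo hz ht
      exact ⟨h.1, h.2.trans hzb⟩
    have hK : HasDerivAt (fun τ : ℝ => eulerKernel (κ - 1) (1 - τ))
        (-((1 - κ) * eulerKernel κ (1 - t))) t :=
      (hasDerivAt_eulerKernel_pred κ ht1).comp_const_sub 1 t
    have hV0 := hasDerivAt_iteratedDeriv_of_contDiffOn isOpen_Ioo hv 0 hw
    rw [iteratedDeriv_zero] at hV0
    have hV : HasDerivAt (fun τ : ℝ => v (eulerPt z τ)) ((z - 1) • iteratedDeriv 1 v (eulerPt z t)) t :=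
      hV0.scomp t (hasDerivAt_eulerPt_t z t)
    have hc : HasDerivAt (fun τ : ℝ => (τ : ℂ)) 1 t := by
      simpa using (hasDerivAt_id t).ofReal_comp
    have h := hK.mul (hc.mul hV)
    have hKs : eulerKernel (κ - 1) (1 - t) = ((1 - t : ℝ) : ℂ) * eulerKernel κ (1 - t) := by
      rw [← mul_eulerKernel_succ (κ - 1) ht1, sub_add_cancel]
    refine h.congr_deriv ?_
    simp only [hφ, eulerΨIntegrand, iteratedDeriv_zero, pow_zero, pow_one, one_mul, Complex.real_smul,
      Pi.mul_apply]
    rw [hKs]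
    push_cast
    ring
  have hint : IntervalIntegrable φ volume 0 1 := by
    have i0 := intervalIntegrable_eulerΨIntegrand hv hbd hBb hr hκ' 0 hz hzB.le
    have i1 := intervalIntegrable_eulerΨIntegrand hv hbd hBb hr hκ' 1 hz hzB.le
    have i2 := intervalIntegrable_eulerΨIntegrand hv hbd hBb hr hκ 0 hz hzB.le
    exact ((i0.const_mul _).add (i1.const_mul _)).sub (i2.const_mul _)
  -- boundary value at `t = 1`
  have h1 : Tendsto Φ (𝓝[<] 1) (𝓝 0) := by
    have hK : Tendsto (fun t : ℝ => eulerKernel (κ - 1) (1 - t)) (𝓝[<] 1) (𝓝 0) := by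
      refine tendsto_zero_iff_norm_tendsto_zero.mpr ?_
      have hp : 0 < 1 - κ.re := by linarith
      refine (tendsto_one_sub_rpow_nhdsLT_one hp).congr' ?_
      filter_upwards [self_mem_nhdsWithin] with t ht
      rw [norm_eulerKernel (κ - 1) (sub_pos.mpr ht)]
      congr 1
      simp
    have hF : Tendsto (fun t : ℝ => (t : ℂ) * v (eulerPt z t)) (𝓝[<] 1)
        (𝓝 (((1 : ℝ) : ℂ) * v (eulerPt z 1))) := by
      have hvz : ContinuousAt v (eulerPt z 1) := by
        have he : eulerPt z 1 = z := by unfold eulerPt; ring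
        rw [he]
        exact (hasDerivAt_iteratedDeriv_of_contDiffOn isOpen_Ioo hv 0 ⟨hz, hzb⟩).continuousAt.congr
          (by simp)
      have hcont : ContinuousAt (fun t : ℝ => (t : ℂ) * v (eulerPt z t)) 1 :=
        Complex.continuous_ofReal.continuousAt.mul
          (hvz.comp (by unfold eulerPt; fun_prop : Continuous fun t : ℝ => eulerPt z t).continuousAt)
      exact hcont.tendsto.mono_left nhdsWithin_le_nhds
    have h := hK.mul hF
    rw [zero_mul] at h
    exact h
  -- boundary value at `t = 0`
  have h0 : Tendsto Φ (𝓝[>] 0) (𝓝 0) := by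
    have hz1 : 0 < z - 1 := sub_pos.mpr hz
    have hmaj : ∀ t ∈ Ioo (0 : ℝ) 1, ‖Φ t‖ ≤ |C₀| * (z - 1) ^ r * t ^ (r + 1) := by
      intro t ht
      have ht1 : 0 < 1 - t := sub_pos.mpr ht.2
      have hw := eulerPt_mem_Ioo hz ht
      have hvw := hC₀ _ ⟨hw.1, hw.2.trans hzB⟩
      rw [iteratedDeriv_zero, eulerPt_sub_one] at hvw
      simp only [Nat.cast_zero, sub_zero] at hvw
      rw [hΦ]
      simp only []
      rw [norm_mul, norm_mul, norm_eulerKernel (κ - 1) ht1, Complex.norm_real, Real.norm_eq_abs,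
        abs_of_pos ht.1]
      have hk1 : (1 - t) ^ (-(κ - 1).re) ≤ 1 := by
        refine Real.rpow_le_one ht1.le (by linarith [ht.1]) ?_
        simp; linarith
      have hv' : ‖v (eulerPt z t)‖ ≤ |C₀| * ((z - 1) ^ r * t ^ r) := by
        refine hvw.trans ?_
        rw [Real.mul_rpow hz1.le ht.1.le]
        exact mul_le_mul_of_nonneg_right (le_abs_self _)
          (mul_nonneg (Real.rpow_nonneg hz1.le _) (Real.rpow_nonneg ht.1.le _))
      have htr : t * t ^ r = t ^ (r + 1) := by
        rw [Real.rpow_add ht.1, Real.rpow_one]; ring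
      calc (1 - t) ^ (-(κ - 1).re) * (t * ‖v (eulerPt z t)‖)
          ≤ 1 * (t * (|C₀| * ((z - 1) ^ r * t ^ r))) :=
            mul_le_mul hk1 (mul_le_mul_of_nonneg_left hv' ht.1.le)
              (mul_nonneg ht.1.le (norm_nonneg _)) zero_le_one
        _ = |C₀| * (z - 1) ^ r * t ^ (r + 1) := by rw [← htr]; ring
    have hlim : Tendsto (fun t : ℝ => |C₀| * (z - 1) ^ r * t ^ (r + 1)) (𝓝[>] 0) (𝓝 0) := by
      have h := (tendsto_rpow_nhdsGT_zero (by linarith : 0 < r + 1)).const_mul (|C₀| * (z - 1) ^ r)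
      rw [mul_zero] at h
      exact h
    refine squeeze_zero_norm' ?_ hlim
    filter_upwards [Ioo_mem_nhdsGT (zero_lt_one' ℝ)] with t ht using hmaj t ht
  have hFTC := intervalIntegral.integral_eq_sub_of_hasDerivAt_of_tendsto zero_lt_one hderiv hint h0 h1
  rw [sub_self] at hFTC
  have hsplit : ∫ t in (0 : ℝ)..1, φ t = (2 - κ) * eulerΨ (κ - 1) v 0 z +
      ((z - 1 : ℝ) : ℂ) * eulerΨ (κ - 1) v 1 z - (1 - κ) * eulerΨ κ v 0 z := by
    have i0 := intervalIntegrable_eulerΨIntegrand hv hbd hBb hr hκ' 0 hz hzB.le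
    have i1 := intervalIntegrable_eulerΨIntegrand hv hbd hBb hr hκ' 1 hz hzB.le
    have i2 := intervalIntegrable_eulerΨIntegrand hv hbd hBb hr hκ 0 hz hzB.le
    rw [hφ, intervalIntegral.integral_sub ((i0.const_mul _).add (i1.const_mul _)) (i2.const_mul _),
      intervalIntegral.integral_add (i0.const_mul _) (i1.const_mul _)]
    simp only [intervalIntegral.integral_const_mul]
    rfl
  rw [hsplit] at hFTC
  linear_combination hFTC

/-! ### The transform `Φ_κ[v](z) = ∫₁^z (z−w)^{−κ} v(w) dw` and its first two derivatives -/

/-- The one-sided Euler / Riemann–Liouville transform in `τ`-form,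
`Φ_κ[v](z) = (z−1)^{1−κ} Ψ_{κ,0}[v](z) = ∫₀¹ F(z,t) dt = ∫₁^z (z−w)^{−κ} v(w) dw` (`Re κ < 1`).
[cite: Takemura2017, Proposition 1.2] -/
def eulerΦ (κ : ℂ) (v : ℝ → ℂ) (z : ℝ) : ℂ :=
  eulerKernel (κ - 1) (z - 1) * eulerΨ κ v 0 z

/-- Closed form of `Φ_κ[v]'`: `(1−κ)(z−1)^{−κ} Ψ_{κ,0} + (z−1)^{1−κ} Ψ_{κ,1}` (`= ∫₀¹ F_z dt`).
[cite: Takemura2017, Proposition 1.2] -/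
def eulerΦ₁ (κ : ℂ) (v : ℝ → ℂ) (z : ℝ) : ℂ :=
  (1 - κ) * eulerKernel κ (z - 1) * eulerΨ κ v 0 z + eulerKernel (κ - 1) (z - 1) * eulerΨ κ v 1 z

/-- Closed form of `Φ_κ[v]''`:
`(z−1)^{−κ−1}[−κ(1−κ) Ψ_{κ,0} + 2(1−κ)(z−1) Ψ_{κ,1} + (z−1)² Ψ_{κ,2}]` (`= ∫₀¹ F_zz dt`).
[cite: Takemura2017, Proposition 1.2] -/
def eulerΦ₂ (κ : ℂ) (v : ℝ → ℂ) (z : ℝ) : ℂ :=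
  eulerKernel (κ + 1) (z - 1) *
    (-κ * (1 - κ) * eulerΨ κ v 0 z + 2 * (1 - κ) * ((z - 1 : ℝ) : ℂ) * eulerΨ κ v 1 z +
      ((z - 1 : ℝ) : ℂ) ^ 2 * eulerΨ κ v 2 z)

/-- `Φ_κ[v]' = eulerΦ₁` on `(1,B)`. [cite: Takemura2017, Proposition 1.2] -/
theorem hasDerivAt_eulerΦ {v : ℝ → ℂ} {b r B : ℝ} {κ : ℂ}
    (hv : ContDiffOn ℝ ((⊤ : ℕ∞) : WithTop ℕ∞) v (Ioo 1 b)) (hbd : EulerBound v r B) (hBb : B ≤ b)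
    (hr : -1 < r) (hκ : κ.re < 1) {z : ℝ} (hz : 1 < z) (hzB : z < B) :
    HasDerivAt (eulerΦ κ v) (eulerΦ₁ κ v z) z := by
  have hz1 : 0 < z - 1 := sub_pos.mpr hz
  have hK : HasDerivAt (fun ζ : ℝ => eulerKernel (κ - 1) (ζ - 1))
      ((1 - κ) * eulerKernel κ (z - 1)) z :=
    (hasDerivAt_eulerKernel_pred κ hz1).comp_sub_const z 1
  have h := hK.mul (hasDerivAt_eulerΨ hv hbd hBb hr hκ 0 hz hzB)
  unfold eulerΦ eulerΦ₁
  refine h.congr_deriv ?_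
  ring

/-- `Φ_κ[v]'' = eulerΦ₂` on `(1,B)`. [cite: Takemura2017, Proposition 1.2] -/
theorem hasDerivAt_eulerΦ₁ {v : ℝ → ℂ} {b r B : ℝ} {κ : ℂ}
    (hv : ContDiffOn ℝ ((⊤ : ℕ∞) : WithTop ℕ∞) v (Ioo 1 b)) (hbd : EulerBound v r B) (hBb : B ≤ b)
    (hr : -1 < r) (hκ : κ.re < 1) {z : ℝ} (hz : 1 < z) (hzB : z < B) :
    HasDerivAt (eulerΦ₁ κ v) (eulerΦ₂ κ v z) z := by
  have hz1 : 0 < z - 1 := sub_pos.mpr hz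
  have hK1 : HasDerivAt (fun ζ : ℝ => eulerKernel (κ - 1) (ζ - 1))
      ((1 - κ) * eulerKernel κ (z - 1)) z :=
    (hasDerivAt_eulerKernel_pred κ hz1).comp_sub_const z 1
  have hK0 : HasDerivAt (fun ζ : ℝ => eulerKernel κ (ζ - 1)) (-κ * eulerKernel (κ + 1) (z - 1)) z :=
    (hasDerivAt_eulerKernel κ hz1).comp_sub_const z 1
  have hΨ0 := hasDerivAt_eulerΨ hv hbd hBb hr hκ 0 hz hzB
  have hΨ1 := hasDerivAt_eulerΨ hv hbd hBb hr hκ 1 hz hzB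
  have h := ((hK0.const_mul (1 - κ)).mul hΨ0).add (hK1.mul hΨ1)
  have hs0 : eulerKernel κ (z - 1) = ((z - 1 : ℝ) : ℂ) * eulerKernel (κ + 1) (z - 1) := by
    rw [← mul_eulerKernel_succ κ hz1]
  have hs1 : eulerKernel (κ - 1) (z - 1) = ((z - 1 : ℝ) : ℂ) ^ 2 * eulerKernel (κ + 1) (z - 1) := by
    rw [← mul_eulerKernel_succ (κ - 1) hz1, sub_add_cancel, hs0]; ring
  unfold eulerΦ₁ eulerΦ₂
  refine h.congr_deriv ?_
  rw [hs0, hs1]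
  ring

/-! ### Power functions on the chart at `w = 1` -/

/-- `d/du (u−1)^ρ = ρ (u−1)^{ρ−1}` for real `u > 1` (principal complex power).
[folklore] -/
private theorem hasDerivAt_ofReal_sub_one_cpow (ρ : ℂ) {w : ℝ} (hw : 1 < w) :
    HasDerivAt (fun u : ℝ => ((u - 1 : ℝ) : ℂ) ^ ρ) (ρ * ((w - 1 : ℝ) : ℂ) ^ (ρ - 1)) w := by
  have hslit : ((w : ℂ) - 1) ∈ Complex.slitPlane := by
    rw [show ((w : ℂ) - 1) = ((w - 1 : ℝ) : ℂ) by push_cast; ring]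
    exact Complex.ofReal_mem_slitPlane.2 (sub_pos.mpr hw)
  have h1 : HasDerivAt (fun x : ℂ => (x - 1) ^ ρ) (ρ * ((w : ℂ) - 1) ^ (ρ - 1) * 1) (w : ℂ) :=
    ((hasDerivAt_id (w : ℂ)).sub_const 1).cpow_const hslit
  have h2 := h1.comp_ofReal
  have hfun : (fun u : ℝ => ((u - 1 : ℝ) : ℂ) ^ ρ) = fun u : ℝ => ((u : ℂ) - 1) ^ ρ := by
    funext u; push_cast; ring_nf
  rw [hfun]
  refine h2.congr_deriv ?_
  push_cast
  ring

/-! ### The Euler transform of a source solution solves the target equation (`Re κ < 1`) -/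

/-- **Euler's integral transformation of Heun's equation along the real segment `(1, z)`
(Takemura's Proposition 1.2 / Kazakov–Slavyanov, case `Re κ < 1`).** Let the target parameters
`(a_H; α, β; γ, δ, ε; q)` satisfy the Fuchs relation and let `κ` be a root, `(κ−α)(κ−β) = 0`,
with `Re κ < 1`. Let `v` be smooth on `(1,b)` with branch-type bounds `EulerBound v r B`
(`B ≤ b`, `r > −1`), of the exact branch form `v = (w−1)^ρ h(w)` near `1⁺` with `h` smooth on a
two-sided neighbourhood of `1` and `ρ = κ − δ` (the non-analytic exponent `1 − δ'` of the SOURCE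
equation at `w = 1`), `Re ρ > −1`, and suppose `v` satisfies the source equation with
inhomogeneity `g` on `(1,B)`: `lead·v'' + mid'·v' + low'·v = g` (source parameters
`eulerSrc γ κ, eulerSrc δ κ, eulerSrc ε κ; eulerSrcα κ, eulerSrcβ α β κ; eulerSrcQ`), `g` of the
same class. Then the transform `Φ = Φ_κ[v]` satisfies, for `1 < z < B`,
`lead(z) Φ'' + mid_{γδε}(z) Φ' + (αβ z + q) Φ = Φ_κ[g](z)`;
in particular (`g = 0`) the Euler transform of a source solution is a target solution. Proof:
differentiate under `∫₀¹` (`hasDerivAt_eulerΨ`), apply the pointwise `τ`-identity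
`euler_tau_identity`, and integrate `∂_t G` over `(0,1)`: `G(z,1⁻) = 0` because `Re κ < 1`,
`G(z,0⁺) = 0` because the two leading terms of `G` cancel exactly for `ρ = κ − δ`
(`Re ρ > −1`). [cite: Takemura2017, Proposition 1.2] -/
theorem heunOperator_eulerΦ {aH α β γ δ ε q κ ρ : ℂ} {v g : ℝ → ℂ} {b r B : ℝ}
    (hF : γ + δ + ε = α + β + 1) (hroot : (κ - α) * (κ - β) = 0) (hκ : κ.re < 1)
    (hv : ContDiffOn ℝ ((⊤ : ℕ∞) : WithTop ℕ∞) v (Ioo 1 b)) (hbd : EulerBound v r B) (hBb : B ≤ b)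
    (hr : -1 < r) (hρ : ρ = κ - δ) (hρre : -1 < ρ.re)
    (hchart : ∃ e : ℝ, 0 < e ∧ ∃ h : ℝ → ℂ, ContDiffOn ℝ ((⊤ : ℕ∞) : WithTop ℕ∞) h (Ioo (1 - e) (1 + e)) ∧
      ∀ w ∈ Ioo 1 (1 + e), v w = ((w - 1 : ℝ) : ℂ) ^ ρ * h w)
    (hg : ContDiffOn ℝ ((⊤ : ℕ∞) : WithTop ℕ∞) g (Ioo 1 b)) (hgbd : EulerBound g r B)
    (hsrc : ∀ w ∈ Ioo 1 B, lead aH w * iteratedDeriv 2 v w +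
      mid aH (eulerSrc γ κ) (eulerSrc δ κ) (eulerSrc ε κ) w * iteratedDeriv 1 v w +
      low (eulerSrcα κ) (eulerSrcβ α β κ) (eulerSrcQ aH γ δ ε q κ) w * v w = g w)
    {z : ℝ} (hz : 1 < z) (hzB : z < B) :
    lead aH z * eulerΦ₂ κ v z + mid aH γ δ ε z * eulerΦ₁ κ v z + low α β q z * eulerΦ κ v z =
      eulerΦ κ g z := by
  have hz1 : 0 < z - 1 := sub_pos.mpr hz
  have hzb : z < b := hzB.trans_le hBb
  -- abbreviations: `v₁ = v'`, `v₂ = v''`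
  set v₁ : ℝ → ℂ := iteratedDeriv 1 v with hv₁
  set v₂ : ℝ → ℂ := iteratedDeriv 2 v with hv₂
  have i0 := intervalIntegrable_eulerΨIntegrand hv hbd hBb hr hκ 0 hz hzB.le
  have i1 := intervalIntegrable_eulerΨIntegrand hv hbd hBb hr hκ 1 hz hzB.le
  have i2 := intervalIntegrable_eulerΨIntegrand hv hbd hBb hr hκ 2 hz hzB.le
  have ig := intervalIntegrable_eulerΨIntegrand hg hgbd hBb hr hκ 0 hz hzB.le
  have hs0 : eulerKernel κ (z - 1) = ((z - 1 : ℝ) : ℂ) * eulerKernel (κ + 1) (z - 1) := by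
    rw [← mul_eulerKernel_succ κ hz1]
  have hs1 : eulerKernel (κ - 1) (z - 1) = ((z - 1 : ℝ) : ℂ) ^ 2 * eulerKernel (κ + 1) (z - 1) := by
    rw [← mul_eulerKernel_succ (κ - 1) hz1, sub_add_cancel, hs0]; ring
  -- (1) the three transforms as integrals of `F0, F1, F2`
  set F0 : ℝ → ℂ := fun t => eulerKernel (κ - 1) (z - 1) * eulerΨIntegrand κ v 0 z t with hF0
  set F1 : ℝ → ℂ := fun t => (1 - κ) * eulerKernel κ (z - 1) * eulerΨIntegrand κ v 0 z t +
      eulerKernel (κ - 1) (z - 1) * eulerΨIntegrand κ v 1 z t with hF1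
  set F2 : ℝ → ℂ := fun t => eulerKernel (κ + 1) (z - 1) *
      (-κ * (1 - κ) * eulerΨIntegrand κ v 0 z t + 2 * (1 - κ) * ((z - 1 : ℝ) : ℂ) * eulerΨIntegrand κ v 1 z t +
        ((z - 1 : ℝ) : ℂ) ^ 2 * eulerΨIntegrand κ v 2 z t) with hF2
  clear_value F0 F1 F2
  have iF0 : IntervalIntegrable F0 volume 0 1 := by rw [hF0]; exact i0.const_mul _
  have iF1 : IntervalIntegrable F1 volume 0 1 := by
    rw [hF1]; exact ((i0.const_mul _).add (i1.const_mul _))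
  have iF2 : IntervalIntegrable F2 volume 0 1 := by
    rw [hF2]; exact (((i0.const_mul _).add (i1.const_mul _)).add (i2.const_mul _)).const_mul _
  have eF0 : ∫ t in (0 : ℝ)..1, F0 t = eulerΦ κ v z := by
    rw [hF0, intervalIntegral.integral_const_mul]; rfl
  have eF1 : ∫ t in (0 : ℝ)..1, F1 t = eulerΦ₁ κ v z := by
    rw [hF1, intervalIntegral.integral_add (i0.const_mul _) (i1.const_mul _),
      intervalIntegral.integral_const_mul, intervalIntegral.integral_const_mul]; rfl
  have eF2 : ∫ t in (0 : ℝ)..1, F2 t = eulerΦ₂ κ v z := by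
    rw [hF2, intervalIntegral.integral_const_mul,
      intervalIntegral.integral_add ((i0.const_mul _).add (i1.const_mul _)) (i2.const_mul _),
      intervalIntegral.integral_add (i0.const_mul _) (i1.const_mul _),
      intervalIntegral.integral_const_mul, intervalIntegral.integral_const_mul,
      intervalIntegral.integral_const_mul]; rfl
  -- the `M_T`-integrand `I` and the source integrand `J`
  set I : ℝ → ℂ := fun t => lead aH z * eulerFzz κ v v₁ v₂ z t + mid aH γ δ ε z * eulerFz κ v v₁ z t +
      low α β q z * eulerF κ v z t with hI
  set J : ℝ → ℂ := fun t => eulerKernel (κ - 1) (z - 1) * eulerΨIntegrand κ g 0 z t with hJ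
  clear_value I J
  have hIeq : ∀ t, I t = lead aH z * F2 t + mid aH γ δ ε z * F1 t + low α β q z * F0 t := by
    intro t
    simp only [hI, hF0, hF1, hF2, eulerFzz, eulerFz, eulerF, eulerΨIntegrand, hv₁, hv₂, iteratedDeriv_zero,
      pow_zero, pow_one, one_mul]
    rw [hs0, hs1]
    ring
  have hIint : IntervalIntegrable I volume 0 1 :=
    (((iF2.const_mul _).add (iF1.const_mul _)).add (iF0.const_mul _)).congr fun t _ => (hIeq t).symm
  have hLHS : lead aH z * eulerΦ₂ κ v z + mid aH γ δ ε z * eulerΦ₁ κ v z + low α β q z * eulerΦ κ v z =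
      ∫ t in (0 : ℝ)..1, I t := by
    rw [intervalIntegral.integral_congr (g := fun t => lead aH z * F2 t + mid aH γ δ ε z * F1 t +
      low α β q z * F0 t) (fun t _ => hIeq t),
      intervalIntegral.integral_add ((iF2.const_mul _).add (iF1.const_mul _)) (iF0.const_mul _),
      intervalIntegral.integral_add (iF2.const_mul _) (iF1.const_mul _),
      intervalIntegral.integral_const_mul (lead aH z) F2, intervalIntegral.integral_const_mul (mid aH γ δ ε z) F1,
      intervalIntegral.integral_const_mul (low α β q z) F0, eF0, eF1, eF2]
  -- (2) pointwise: `I = ∂_t G + J` on `(0,1)` (the τ-identity and the source relation)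
  have hderivs : ∀ t ∈ Ioc (0 : ℝ) 1, HasDerivAt v (v₁ (eulerPt z t)) (eulerPt z t) ∧
      HasDerivAt v₁ (v₂ (eulerPt z t)) (eulerPt z t) := by
    intro t ht
    have hw : eulerPt z t ∈ Ioo 1 b := by
      have h := eulerPt_mem_Ioc hz ht
      exact ⟨h.1, lt_of_le_of_lt h.2 hzb⟩
    have h0 := hasDerivAt_iteratedDeriv_of_contDiffOn isOpen_Ioo hv 0 hw
    have h1 := hasDerivAt_iteratedDeriv_of_contDiffOn isOpen_Ioo hv 1 hw
    rw [iteratedDeriv_zero] at h0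
    exact ⟨h0, h1⟩
  have hIJ : ∀ t ∈ Ioo (0 : ℝ) 1, I t = eulerGt aH γ δ ε κ v v₁ v₂ z t + J t := by
    intro t ht
    have key := euler_tau_identity (aH := aH) (q := q) hF hroot v v₁ v₂ hz ht.2
    have hw := eulerPt_mem_Ioo hz ht
    have hs := hsrc (eulerPt z t) ⟨hw.1, hw.2.trans hzB⟩
    have hI' : I t = eulerGt aH γ δ ε κ v v₁ v₂ z t + eulerKernel (κ - 1) (z - 1) * eulerKernel κ (1 - t) *
        (lead aH (eulerPt z t) * v₂ (eulerPt z t) +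
          mid aH (eulerSrc γ κ) (eulerSrc δ κ) (eulerSrc ε κ) (eulerPt z t) * v₁ (eulerPt z t) +
          low (eulerSrcα κ) (eulerSrcβ α β κ) (eulerSrcQ aH γ δ ε q κ) (eulerPt z t) * v (eulerPt z t)) := by
      rw [hI]
      linear_combination key
    rw [hI', hs, hJ]
    simp only [eulerΨIntegrand, iteratedDeriv_zero, pow_zero, one_mul]
    ring
  -- (3) `∫₀¹ ∂_t G = G(1⁻) − G(0⁺) = 0`
  have hae1 : ∀ᵐ t : ℝ ∂volume, t ≠ 1 := by
    have : ({1}ᶜ : Set ℝ) ∈ ae volume := by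
      rw [compl_mem_ae_iff]; exact measure_singleton 1
    filter_upwards [this] with t ht using ht
  have hJint : IntervalIntegrable J volume 0 1 := by rw [hJ]; exact ig.const_mul _
  have hGt_int : IntervalIntegrable (fun t => eulerGt aH γ δ ε κ v v₁ v₂ z t) volume 0 1 := by
    refine (hIint.sub hJint).congr_uIoo ?_
    intro t ht
    rw [uIoo_of_le zero_le_one] at ht
    simp only []
    rw [hIJ t ht]
    ring
  have hGderiv : ∀ t ∈ Ioo (0 : ℝ) 1, HasDerivAt (fun τ => eulerG aH γ δ ε κ v v₁ z τ)
      (eulerGt aH γ δ ε κ v v₁ v₂ z t) t := fun t ht =>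
    hasDerivAt_eulerG ht.2 (hderivs t ⟨ht.1, ht.2.le⟩).1 (hderivs t ⟨ht.1, ht.2.le⟩).2
  have hcontPt : Continuous fun t : ℝ => eulerPt z t := by unfold eulerPt; fun_prop
  -- limit at `t = 1`: the factor `(1−t)^{1−κ}` kills a bounded bracket
  have hG1 : Tendsto (fun τ => eulerG aH γ δ ε κ v v₁ z τ) (𝓝[<] 1) (𝓝 0) := by
    have hK : Tendsto (fun t : ℝ => eulerKernel κ (z - 1) * eulerKernel (κ - 1) (1 - t)) (𝓝[<] 1)
        (𝓝 0) := by
      have h0 : Tendsto (fun t : ℝ => eulerKernel (κ - 1) (1 - t)) (𝓝[<] 1) (𝓝 0) := by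
        refine tendsto_zero_iff_norm_tendsto_zero.mpr ?_
        have hp : 0 < 1 - κ.re := by linarith
        refine (tendsto_one_sub_rpow_nhdsLT_one hp).congr' ?_
        filter_upwards [self_mem_nhdsWithin] with t ht
        rw [norm_eulerKernel (κ - 1) (sub_pos.mpr ht)]
        congr 1
        simp
      have h := h0.const_mul (eulerKernel κ (z - 1))
      rw [mul_zero] at h
      exact h
    -- the bracket is continuous at `t = 1`
    set BR : ℝ → ℂ := fun t =>
      -((aH - 1) * (κ - δ) + (2 * κ - γ - δ - ε) * (t : ℂ) * ((z - 1 : ℝ) : ℂ) ^ 2) * v (eulerPt z t) +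
        ((z - 1 : ℝ) : ℂ) * (t : ℂ) * ((t : ℂ) * ((z - 1 : ℝ) : ℂ) ^ 2 + aH - 1) * v₁ (eulerPt z t)
      with hBR
    have he1 : eulerPt z 1 = z := by unfold eulerPt; ring
    have hvz : ContinuousAt (fun t : ℝ => v (eulerPt z t)) 1 := by
      have h0 := hasDerivAt_iteratedDeriv_of_contDiffOn isOpen_Ioo hv 0 ⟨hz, hzb⟩
      rw [iteratedDeriv_zero] at h0
      have : ContinuousAt v (eulerPt z 1) := by rw [he1]; exact h0.continuousAt
      exact this.comp hcontPt.continuousAt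
    have hv₁z : ContinuousAt (fun t : ℝ => v₁ (eulerPt z t)) 1 := by
      have h1 := hasDerivAt_iteratedDeriv_of_contDiffOn isOpen_Ioo hv 1 ⟨hz, hzb⟩
      have : ContinuousAt v₁ (eulerPt z 1) := by rw [he1]; exact h1.continuousAt
      exact this.comp hcontPt.continuousAt
    have hA : Continuous fun t : ℝ =>
        -((aH - 1) * (κ - δ) + (2 * κ - γ - δ - ε) * (t : ℂ) * ((z - 1 : ℝ) : ℂ) ^ 2) := by
      fun_prop
    have hB : Continuous fun t : ℝ =>
        ((z - 1 : ℝ) : ℂ) * (t : ℂ) * ((t : ℂ) * ((z - 1 : ℝ) : ℂ) ^ 2 + aH - 1) := by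
      fun_prop
    have hBRc : ContinuousAt BR 1 := (hA.continuousAt.mul hvz).add (hB.continuousAt.mul hv₁z)
    have h := hK.mul (hBRc.tendsto.mono_left nhdsWithin_le_nhds)
    rw [zero_mul] at h
    refine h.congr' ?_
    filter_upwards [self_mem_nhdsWithin] with t _
    simp only [hBR, eulerG]
  -- limit at `t = 0`: the exact cancellation of the two leading terms for `ρ = κ − δ`
  have hG0 : Tendsto (fun τ => eulerG aH γ δ ε κ v v₁ z τ) (𝓝[>] 0) (𝓝 0) := by
    obtain ⟨e, he, h, hh, hvh⟩ := hchart
    -- on the chart: `v = (w−1)^ρ h`, `v₁ = ρ (w−1)^{ρ−1} h + (w−1)^ρ h'`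
    have hchart_open : IsOpen (Ioo (1 - e) (1 + e)) := isOpen_Ioo
    have h1mem : (1 : ℝ) ∈ Ioo (1 - e) (1 + e) := ⟨by linarith, by linarith⟩
    have hh1 : ContinuousAt h 1 := (hh.continuousOn.continuousWithinAt h1mem).continuousAt
      (hchart_open.mem_nhds h1mem)
    have hhd : ∀ w ∈ Ioo (1 - e) (1 + e), HasDerivAt h (deriv h w) w := fun w hw =>
      ((hh.differentiableOn (by simp)).differentiableAt (hchart_open.mem_nhds hw)).hasDerivAt
    have hh'1 : ContinuousAt (deriv h) 1 := by
      have hd : ContDiffOn ℝ ((⊤ : ℕ∞) : WithTop ℕ∞) (deriv h) (Ioo (1 - e) (1 + e)) := by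
        have := ((contDiffOn_succ_iff_deriv_of_isOpen (𝕜 := ℝ)
          (n := ((⊤ : ℕ∞) : WithTop ℕ∞)) hchart_open).1 (by simpa using hh))
        simpa using this.2.2
      exact (hd.continuousOn.continuousWithinAt h1mem).continuousAt (hchart_open.mem_nhds h1mem)
    have hv₁_chart : ∀ w ∈ Ioo 1 (1 + e),
        v₁ w = ρ * ((w - 1 : ℝ) : ℂ) ^ (ρ - 1) * h w + ((w - 1 : ℝ) : ℂ) ^ ρ * deriv h w := by
      intro w hw
      have hloc : v =ᶠ[𝓝 w] fun u => ((u - 1 : ℝ) : ℂ) ^ ρ * h u := by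
        filter_upwards [isOpen_Ioo.mem_nhds hw] with u hu using hvh u hu
      have hd : HasDerivAt (fun u => ((u - 1 : ℝ) : ℂ) ^ ρ * h u)
          (ρ * ((w - 1 : ℝ) : ℂ) ^ (ρ - 1) * h w + ((w - 1 : ℝ) : ℂ) ^ ρ * deriv h w) w :=
        (hasDerivAt_ofReal_sub_one_cpow ρ hw.1).mul (hhd w ⟨by linarith [hw.1], hw.2⟩)
      rw [hv₁, iteratedDeriv_one, hloc.deriv_eq, hd.deriv]
    -- `t₀`: small parameters land in the chart
    set t₀ : ℝ := min 1 (e / (z - 1)) / 2 with ht₀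
    have ht₀pos : 0 < t₀ := by
      rw [ht₀]; have := lt_min zero_lt_one (div_pos he hz1); linarith
    have ht₀1 : t₀ < 1 := by
      rw [ht₀]; have := min_le_left (1 : ℝ) (e / (z - 1)); linarith
    have ht₀e : ∀ t ∈ Ioo (0 : ℝ) t₀, (z - 1) * t < e := by
      intro t ht
      have h1 : t < e / (z - 1) := by
        have := min_le_right (1 : ℝ) (e / (z - 1)); rw [ht₀] at ht; linarith [ht.2]
      calc (z - 1) * t < (z - 1) * (e / (z - 1)) := by gcongr
        _ = e := by field_simp
    -- the bracket on the chart: `BR(t) = (w−1)^ρ · t · Q(t)`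
    set Q : ℝ → ℂ := fun t => ((z - 1 : ℝ) : ℂ) ^ 2 * (ρ - (2 * κ - γ - δ - ε)) * h (eulerPt z t) +
      ((t : ℂ) * ((z - 1 : ℝ) : ℂ) ^ 2 + aH - 1) * ((z - 1 : ℝ) : ℂ) * deriv h (eulerPt z t) with hQ
    have hGeq : ∀ t ∈ Ioo (0 : ℝ) t₀, eulerG aH γ δ ε κ v v₁ z t =
        (eulerKernel κ (z - 1) * eulerKernel (κ - 1) (1 - t)) *
          ((((z - 1) * t : ℝ) : ℂ) ^ ρ * (t : ℂ) * Q t) := by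
      intro t ht
      have ht1 : t < 1 := ht.2.trans ht₀1
      have hw1 : 1 < eulerPt z t := (eulerPt_mem_Ioo hz ⟨ht.1, ht1⟩).1
      have hwe : eulerPt z t < 1 + e := by
        unfold eulerPt; linarith [ht₀e t ht]
      have hvw := hvh (eulerPt z t) ⟨hw1, hwe⟩
      have hv₁w := hv₁_chart (eulerPt z t) ⟨hw1, hwe⟩
      rw [eulerPt_sub_one] at hvw hv₁w
      have hP0 : ((((z - 1) * t : ℝ) : ℂ)) ≠ 0 := by
        exact_mod_cast (mul_pos hz1 ht.1).ne'
      have hPm1 : (((z - 1) * t : ℝ) : ℂ) ^ (ρ - 1) =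
          (((z - 1) * t : ℝ) : ℂ) ^ ρ / (((z - 1) * t : ℝ) : ℂ) := by
        rw [Complex.cpow_sub _ _ hP0, Complex.cpow_one]
      rw [hPm1] at hv₁w
      have htC : (t : ℂ) ≠ 0 := by exact_mod_cast ht.1.ne'
      have hzC : ((z - 1 : ℝ) : ℂ) ≠ 0 := by exact_mod_cast hz1.ne'
      have hcast : (((z - 1) * t : ℝ) : ℂ) = ((z - 1 : ℝ) : ℂ) * (t : ℂ) := by push_cast; ring
      simp only [eulerG, hvw, hv₁w, hQ]
      -- clear the denominator `(z−1)t` and use `ρ = κ − δ`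
      rw [hcast, hρ]
      field_simp
      ring
    -- `(w−1)^ρ · t → 0` and `Q(t) → Q(0)`
    have hPt : Tendsto (fun t : ℝ => (((z - 1) * t : ℝ) : ℂ) ^ ρ * (t : ℂ)) (𝓝[>] 0) (𝓝 0) := by
      refine tendsto_zero_iff_norm_tendsto_zero.mpr ?_
      have hlim : Tendsto (fun t : ℝ => (z - 1) ^ ρ.re * t ^ (ρ.re + 1)) (𝓝[>] 0) (𝓝 0) := by
        have h := (tendsto_rpow_nhdsGT_zero (by linarith : 0 < ρ.re + 1)).const_mul ((z - 1) ^ ρ.re)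
        rw [mul_zero] at h; exact h
      refine hlim.congr' ?_
      filter_upwards [self_mem_nhdsWithin] with t ht
      have ht0 : 0 < t := ht
      rw [norm_mul, Complex.norm_real, Real.norm_eq_abs, abs_of_pos ht0,
        Complex.norm_cpow_eq_rpow_re_of_pos (mul_pos hz1 ht0), Real.mul_rpow hz1.le ht0.le,
        Real.rpow_add ht0, Real.rpow_one]
      ring
    have he0 : eulerPt z 0 = 1 := by unfold eulerPt; ring
    have hQc : ContinuousAt Q 0 := by
      have hh0 : ContinuousAt (fun t : ℝ => h (eulerPt z t)) 0 := by
        have : ContinuousAt h (eulerPt z 0) := by rw [he0]; exact hh1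
        exact this.comp hcontPt.continuousAt
      have hh'0 : ContinuousAt (fun t : ℝ => deriv h (eulerPt z t)) 0 := by
        have : ContinuousAt (deriv h) (eulerPt z 0) := by rw [he0]; exact hh'1
        exact this.comp hcontPt.continuousAt
      have hC : Continuous fun t : ℝ => ((t : ℂ) * ((z - 1 : ℝ) : ℂ) ^ 2 + aH - 1) * ((z - 1 : ℝ) : ℂ) := by
        fun_prop
      exact (continuousAt_const.mul hh0).add (hC.continuousAt.mul hh'0)
    have hK0 : ContinuousAt (fun t : ℝ => eulerKernel κ (z - 1) * eulerKernel (κ - 1) (1 - t)) 0 := by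
      refine continuousAt_const.mul ?_
      have h1 : ContinuousAt (eulerKernel (κ - 1)) (1 - 0) :=
        (continuousOn_eulerKernel (κ - 1)).continuousAt (Ioi_mem_nhds (by norm_num))
      exact ContinuousAt.comp (g := eulerKernel (κ - 1)) (f := fun t : ℝ => 1 - t) h1
        (continuous_const.sub continuous_id).continuousAt
    have h := (hK0.tendsto.mono_left nhdsWithin_le_nhds).mul
      ((hPt.mul (hQc.tendsto.mono_left nhdsWithin_le_nhds)))
    rw [zero_mul, mul_zero] at h
    refine h.congr' ?_
    filter_upwards [Ioo_mem_nhdsGT ht₀pos] with t ht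
    rw [hGeq t ht]
  have hFTC := intervalIntegral.integral_eq_sub_of_hasDerivAt_of_tendsto zero_lt_one hGderiv hGt_int hG0 hG1
  rw [sub_self] at hFTC
  -- (4) assemble
  have hIsplit : ∫ t in (0 : ℝ)..1, I t = (∫ t in (0 : ℝ)..1, eulerGt aH γ δ ε κ v v₁ v₂ z t) +
      ∫ t in (0 : ℝ)..1, J t := by
    rw [← intervalIntegral.integral_add hGt_int hJint]
    refine intervalIntegral.integral_congr_ae ?_
    rw [uIoc_of_le zero_le_one]
    filter_upwards [hae1] with t ht1 ht
    exact hIJ t ⟨ht.1, lt_of_le_of_ne ht.2 ht1⟩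
  have eJ : ∫ t in (0 : ℝ)..1, J t = eulerΦ κ g z := by
    rw [hJ, intervalIntegral.integral_const_mul]; rfl
  rw [hLHS, hIsplit, hFTC, zero_add, eJ]

end GeneralHeun

end Literature.Analysis.ODE
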